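import Summits.CriticalPhenomena.PercolationContinuityZ3.Theorems.PercNearOneGluingNoHeavyQuantGluedWindowLightInc
import HarnessLib

/-!
# QUANT lane R8, T-DEC: LEMMA W's pair condition — the HEAVY-TOP cell of the two-row regime, branch I (h a mid, both rows light into h, the bottom copy of
# `l` HEAVY into its top copy `A = l+r+k`, and `A` too small to absorb it: `t₂ϖ_A ≤ t₀`) PROVED WITHOUT THE CONJECTURE by the structured certificate
# "row `l` takes the whole top copy, the copies of `h` are shared" (arm-1 gen 61, architect)

builds on p205010 (kernel theorem, internal audit signed; external expert review pending)

Support file (`--supports stmt-CriticalPhenomena-4575`), QUANT lane seat prim-quant-arm-1 (gen 61, architect); memo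
`run/shared/lean/prim/quant/prim-quant-arm-1-g61/ARCH-G61.md` §1–§3.  Theorems only; standard axioms, no sorries, no definitions.

THE CELL.  Band frame and price system of `gluedPullback_windowPair_of_lemmaW`; light window pair `(l, h)` below a cheap atom `c ≥ h`; the two-row regime with
`h` a mid (`2(l+r) < T ≤ 2(l+r+k)`, `l+r+k ≤ j`, `T ≤ 2h`), the pair still LIGHT at the glued target (`T − 2l ≤ y(h−l)`), and the bottom copy of `l` COMPATIBLE
with the top copy (`T < 2l + r + k`; it is then HEAVY for it, `y(r+k) ≤ a·m ≤ T − 2l` being automatic in the band).  STRUCTURED CERTIFICATE (memo §1: in this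
family the greedy rule "row `l` into `A` first" is feasible in every sampled configuration, and it DECOUPLES the statuses of the middle copy): row `l` takes ALL
of `A` (share 1, exact heavy power `ϖ_A = (2l+r+k−T)/(T−2l)`) and the fraction `σ = ((1−γ)t₀ − (1−γ)t₂ϖ_A)/(γϖ_a)` of every copy of `h` (exact light power
`ϖ_a` of `(l,h)`; `h+r` and the discounted pool absorb at least as well); row `l+r` takes the fraction `1−σ` of the copies of `h` (power `ϖ_b` of `(l+r,h)`)
and nothing of `A` — so NO status of `(l+r, A)` enters.  BRANCH I is `t₂ϖ_A ≤ t₀` (`σ ≥ 0`).  The one inequality left, `(1−γ)((t₀−t₂ϖ_A)/ϖ_a + t₁/ϖ_b) ≤ γ`,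
is (arm-1 g60's `lightOnly_main_of_star5` with `t₀ ↦ t₀ − t₂ϖ_A`, `t₂ ↦ t₂(1+ϖ_A)`) the Z-form (★I)
`(t₀ − t₂(κ−ν)/ν)/c + t₁(1−ε)/(c+(1−y)ε) + (1−y)t₂κ/ν ≤ 1/(c + t₁ε + t₂κ)` (`ν = N/d = 1+y−c`, `ε = r/d`, `κ = (r+k)/d`, `A/d ≤ m/d = t₁ε + t₂κ`) — and (★I)
needs NO new certificate: it is `lightInc_star` (★7′, the inequality of the cell in which `A` is unreachable, right side `1/(c + t₁ε + t₂ν)`) plus the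
TRANSFER inequality `topTransfer`: `1/(c+t₁ε+t₂ν) − 1/(c+t₁ε+t₂κ) ≤ t₂ϖ_A(1/c − (1−y))` — the loss in the target credit `A ≤ m` from `t₂N` to `t₂K` is
exactly paid by routing the mass `t₂ϖ_A` through `A` instead of `h`, because `1 − (1−y)c = y² + (1−y)ν ≥ ν` (the light gate of `(l,h)` at `T` exceeds its
credit ratio) and `c ≥ 1`.  **`gluedPullback_windowPair_twoRow_heavyTopI`**.  Branch II (`t₀ < t₂ϖ_A`) and the middle copy's status: `…QuantGluedWindowHeavyTop*`.

HONEST STATUS.  `GluedLemmaW` (flow form), `GluedDominatedMass`, the band, `SiblingStep`, `FarTreeRow` OPEN; RATE class (log\*) / honest sentence of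
`run/shared/lean/prim/quant/README.md` unchanged.  [this work].  Nothing here is cited as a published result.  The gluing rows served
[cite: KozmaNitzan2024, Conjecture 3 (p. 15)]; product measure [cite: Grimmett1999, §1.3 p. 10].
-/

set_option maxHeartbeats 4000000

noncomputable section

namespace Summit.CriticalPhenomena.PercolationContinuityZ3.Theorems
namespace Quant
namespace LawDec

/-- **TRANSFER**: `c ≥ 1`, `ν = 1 + y − c > 0`, `ν ≤ κ`, `t₁, t₂, ε ≥ 0`, `y < 1` ⟹
`1/(c + t₁ε + t₂ν) ≤ 1/(c + t₁ε + t₂κ) + t₂((κ−ν)/ν)(1/c − (1−y))` — since `1 − (1−y)c = y² + (1−y)ν ≥ ν` (from `ν ≤ y`, i.e. `c ≥ 1`) and both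
denominators are `≥ c ≥ 1`. [this work] -/
theorem topTransfer (y t1 t2 c e k : ℝ) (hy0 : 0 < y) (hy1 : y < 1) (ht1 : 0 ≤ t1) (ht2 : 0 ≤ t2) (hc1 : 1 ≤ c) (hcy : c < 1 + y)
    (he0 : 0 ≤ e) (hkn : 1 + y - c ≤ k) :
    1 / (c + t1 * e + t2 * (1 + y - c)) ≤ 1 / (c + t1 * e + t2 * k) + t2 * ((k - (1 + y - c)) / (1 + y - c)) * (1 / c - (1 - y)) := by
  have hn0 : 0 < 1 + y - c := by linarith
  have hc0 : 0 < c := by linarith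
  have a1 : 0 ≤ t1 * e := mul_nonneg ht1 he0
  have hDn : c ≤ c + t1 * e + t2 * (1 + y - c) := by nlinarith [mul_nonneg ht2 hn0.le]
  have hDk : c ≤ c + t1 * e + t2 * k := by nlinarith [mul_nonneg ht2 (show (0:ℝ) ≤ k by linarith)]
  have hDn0 : 0 < c + t1 * e + t2 * (1 + y - c) := by linarith
  have hDk0 : 0 < c + t1 * e + t2 * k := by linarith
  have e1 : 1 / (c + t1 * e + t2 * (1 + y - c)) - 1 / (c + t1 * e + t2 * k)
      = t2 * (k - (1 + y - c)) * (1 / ((c + t1 * e + t2 * (1 + y - c)) * (c + t1 * e + t2 * k))) := by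
    rw [div_sub_div _ _ hDn0.ne' hDk0.ne', mul_one_div]; congr 1; ring
  have e2 : t2 * ((k - (1 + y - c)) / (1 + y - c)) * (1 / c - (1 - y))
      = t2 * (k - (1 + y - c)) * ((y ^ 2 + (1 - y) * (1 + y - c)) / ((1 + y - c) * c)) := by
    field_simp
    ring
  have key : 1 / ((c + t1 * e + t2 * (1 + y - c)) * (c + t1 * e + t2 * k)) ≤ (y ^ 2 + (1 - y) * (1 + y - c)) / ((1 + y - c) * c) := by
    rw [div_le_div_iff₀ (mul_pos hDn0 hDk0) (mul_pos hn0 hc0), one_mul]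
    have hG : 1 + y - c ≤ y ^ 2 + (1 - y) * (1 + y - c) := by nlinarith
    calc (1 + y - c) * c ≤ (y ^ 2 + (1 - y) * (1 + y - c)) * c := mul_le_mul_of_nonneg_right hG hc0.le
      _ = (y ^ 2 + (1 - y) * (1 + y - c)) * (c * 1) := by rw [mul_one]
      _ ≤ (y ^ 2 + (1 - y) * (1 + y - c)) * ((c + t1 * e + t2 * (1 + y - c)) * (c + t1 * e + t2 * k)) := by
          apply mul_le_mul_of_nonneg_left _ (by linarith)
          exact mul_le_mul hDn (by linarith) zero_le_one (by linarith)
  have h3 := mul_le_mul_of_nonneg_left key (mul_nonneg ht2 (show (0:ℝ) ≤ k - (1 + y - c) by linarith))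
  rw [← e2, ← e1] at h3
  linarith

/-- (★I) in division form: on the box `0 < y ≤ t₂`, `t₁ ≥ 0`, `t₀ = 1 − t₁ − t₂ ≥ 0`, `1 ≤ c < 1 + y` (`ν := 1 + y − c > 0`), `0 ≤ 2ε ≤ ν ≤ κ`:
`(t₀ − t₂(κ−ν)/ν)/c + t₁(1−ε)/(c+(1−y)ε) + (1−y)t₂κ/ν ≤ 1/(c + t₁ε + t₂κ)` — `lightInc_star` (★7′) plus `topTransfer`. [this work] -/
theorem heavyTopI_star (y t1 t2 c e k : ℝ) (hy0 : 0 < y) (hyt2 : y ≤ t2) (ht1 : 0 ≤ t1) (ht0 : 0 ≤ 1 - t1 - t2) (hc1 : 1 ≤ c)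
    (hcy : c < 1 + y) (he0 : 0 ≤ e) (he1 : 2 * e ≤ 1 + y - c) (hy1 : y < 1) (hkn : 1 + y - c ≤ k) :
    ((1 - t1 - t2) - t2 * (k - (1 + y - c)) / (1 + y - c)) / c + t1 * (1 - e) / (c + (1 - y) * e) + (1 - y) * t2 * k / (1 + y - c)
      ≤ 1 / (c + t1 * e + t2 * k) := by
  have hn0 : 0 < 1 + y - c := by linarith
  have L7 := lightInc_star y c e t1 t2 hy0 hyt2 ht1 ht0 hc1 hcy.le he0 he1 hy1
  have tr := topTransfer y t1 t2 c e k hy0 hy1 ht1 (by linarith) hc1 hcy he0 hkn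
  obtain ⟨P, hP⟩ : ∃ P : ℝ, P = t2 * (k - (1 + y - c)) / (1 + y - c) := ⟨_, rfl⟩
  have e1 : ((1 - t1 - t2) - t2 * (k - (1 + y - c)) / (1 + y - c)) / c = (1 - t1 - t2) / c - P / c := by rw [hP, sub_div]
  have e2 : (1 - y) * t2 * k / (1 + y - c) = t2 * (1 - y) + (1 - y) * P := by
    have hne : 1 + y - c ≠ 0 := hn0.ne'
    rw [hP]
    field_simp
    ring
  have e3 : t2 * ((k - (1 + y - c)) / (1 + y - c)) * (1 / c - (1 - y)) = P / c - (1 - y) * P := by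
    rw [hP, mul_div_assoc]; ring
  rw [e1, e2]
  rw [e3] at tr
  linarith

/-- **THE HEAVY-TOP CELL OF THE TWO-ROW REGIME, BRANCH I (h a mid)**: `T − 2l ≤ y(h − l)` (the pair is light at the glued target), `T < 2l + r + k` (the bottom
copy of `l` can use the top copy) and `qg·(2l+r+k−T) ≤ (1−q)(T−2l)` (branch I: `t₂ϖ_A ≤ t₀`) ⟹ `(1−γ)Ψ(l) + γΨ(h) ≤ 0` for every price system and every cheap
`c ≥ h` — no `GluedLemmaW`; the status of the middle copy w.r.t. the top copy is irrelevant. [this work] -/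
theorem gluedPullback_windowPair_twoRow_heavyTopI (x a q g S : ℝ) (B r k j l h c ls : ℕ) (α p : ℕ → ℝ)
    (hx0 : 0 < x) (hx1 : x < 1) (ha0 : 0 < a) (ha1 : a ≤ 1) (hq0 : 0 < q) (hq1 : q < 1) (hg0 : 0 ≤ g) (hg1 : g ≤ 1) (hr : 1 ≤ r) (hk : 1 ≤ k)
    (hxqg : x ≤ q * g)
    (hlh : l < h) (hhB : h ≤ B) (hhj : h ≤ j) (hwin : j < h + r + k) (hlow : 2 * (l : ℝ) < a * S) (hcomp : a * S < (l : ℝ) + h)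
    (hlight : pairGate (a * x) (a * S) l h < a * x)
    (hL2j : l + r + k ≤ j) (hL2mid : a * (S + q * ((r : ℝ) + k * g)) ≤ 2 * ((l : ℝ) + r + k))
    (hL1low : 2 * ((l : ℝ) + r) < a * (S + q * ((r : ℝ) + k * g))) (hhmid : a * (S + q * ((r : ℝ) + k * g)) ≤ 2 * (h : ℝ))
    (hAcomp : a * (S + q * ((r : ℝ) + k * g)) < 2 * (l : ℝ) + r + k)
    (hbrI : q * g * (2 * (l : ℝ) + r + k - a * (S + q * ((r : ℝ) + k * g))) ≤ (1 - q) * (a * (S + q * ((r : ℝ) + k * g)) - 2 * (l : ℝ)))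
    (hlightT : a * (S + q * ((r : ℝ) + k * g)) - 2 * (l : ℝ) ≤ (a * x) * ((h : ℝ) - l))
    (hhc : h ≤ c) (hcB : c ≤ B) (hcj : c ≤ j)
    (hp : ∀ h, 0 ≤ p h)
    (hαp : ∀ l' h', l' ≤ j → 2 * (l' : ℝ) < a * (S + q * ((r : ℝ) + k * g)) → h' ≤ B + (r + k) →
      (j + 1 ≤ h' ∨ a * (S + q * ((r : ℝ) + k * g)) < (l' : ℝ) + h') →
      α l' ≤ usage (a * x) (a * (S + q * ((r : ℝ) + k * g))) j l' h' * p h')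
    (hcheap : -(gluedPullback (a * (S + q * ((r : ℝ) + k * g))) q g j r k α p c) * (a * x)
      < (1 - a * x) * gluedPullback (a * (S + q * ((r : ℝ) + k * g))) q g j r k α p ls) :
    (1 - pairGate (a * x) (a * S) l h) * gluedPullback (a * (S + q * ((r : ℝ) + k * g))) q g j r k α p l
      + pairGate (a * x) (a * S) l h * gluedPullback (a * (S + q * ((r : ℝ) + k * g))) q g j r k α p h ≤ 0 := by
  -- names (no `set`: the reduction theorem is applied to the original expressions at the end)
  obtain ⟨y, hy⟩ : ∃ y : ℝ, y = a * x := ⟨_, rfl⟩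
  obtain ⟨T, hT⟩ : ∃ T : ℝ, T = a * (S + q * ((r : ℝ) + k * g)) := ⟨_, rfl⟩
  obtain ⟨T₀, hT₀⟩ : ∃ T₀ : ℝ, T₀ = a * S := ⟨_, rfl⟩
  have hy0 : 0 < y := by rw [hy]; exact mul_pos ha0 hx0
  have hyx : y ≤ x := by rw [hy]; nlinarith
  have hy1 : y < 1 := by linarith
  have h1y : 0 < 1 - y := by linarith
  obtain ⟨t1, ht1⟩ : ∃ t1 : ℝ, t1 = q * (1 - g) := ⟨_, rfl⟩
  obtain ⟨t2, ht2⟩ : ∃ t2 : ℝ, t2 = q * g := ⟨_, rfl⟩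
  have ht1p : 0 ≤ t1 := by rw [ht1]; exact mul_nonneg hq0.le (by linarith)
  have ht2p : 0 ≤ t2 := by rw [ht2]; exact mul_nonneg hq0.le hg0
  have ht0p : 0 ≤ 1 - t1 - t2 := by
    rw [ht1, ht2, show 1 - q * (1 - g) - q * g = 1 - q by ring]; linarith
  have hyt2 : y ≤ t2 := by rw [ht2]; linarith
  have hr1 : (1:ℝ) ≤ r := by exact_mod_cast hr
  have hk1 : (1:ℝ) ≤ k := by exact_mod_cast hk
  have hr0 : (0:ℝ) ≤ r := by linarith
  have hk0 : (0:ℝ) ≤ k := by linarith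
  have hlh' : (l : ℝ) < h := by exact_mod_cast hlh
  -- geometry: d = h − l, N = T − 2l, A = T − T₀ ≤ m = t1 r + t2 (r+k)
  obtain ⟨d, hd⟩ : ∃ d : ℝ, d = (h : ℝ) - l := ⟨_, rfl⟩
  have hd0 : 0 < d := by rw [hd]; linarith
  obtain ⟨N, hN⟩ : ∃ N : ℝ, N = T - 2 * (l : ℝ) := ⟨_, rfl⟩
  have hA : T - T₀ = a * (q * ((r : ℝ) + k * g)) := by rw [hT, hT₀]; ring
  have em : q * (1 - g) * (r : ℝ) + q * g * ((r : ℝ) + k) = q * ((r : ℝ) + k * g) := by ring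
  have hAm : T - T₀ ≤ t1 * r + t2 * ((r : ℝ) + k) := by
    rw [hA, ht1, ht2]
    have h1 : a * (q * ((r : ℝ) + k * g)) ≤ 1 * (q * ((r : ℝ) + k * g)) :=
      mul_le_mul_of_nonneg_right ha1 (by positivity)
    linarith [h1, em]
  have hA0 : 0 ≤ T - T₀ := by rw [hA]; positivity
  have hN0 : 0 < N := by rw [hN, hT]; linarith
  have hNK : N < (r : ℝ) + k := by rw [hN, hT]; linarith              -- row l compatible with A
  have hNy : N ≤ y * d := by rw [hN, hd, hT, hy]; exact hlightT      -- light at T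
  have hNd : N < d := lt_of_le_of_lt hNy ((mul_lt_iff_lt_one_left hd0).mpr hy1)
  have h2rN : 2 * (r : ℝ) < N := by rw [hN, hT]; linarith
  -- y (r+k) ≤ a m ≤ N: the bottom copy is HEAVY for the top copy (automatic in the band)
  have hxq : x ≤ q := le_trans hxqg (by nlinarith)
  have hxK : x * ((r : ℝ) + k) ≤ q * ((r : ℝ) + k * g) := by
    have e1 : x * (r : ℝ) ≤ q * r := mul_le_mul_of_nonneg_right hxq hr0
    have e2 : x * (k : ℝ) ≤ q * g * k := mul_le_mul_of_nonneg_right hxqg hk0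
    linarith [e1, e2]
  have hyK : y * ((r : ℝ) + k) ≤ N := by
    have e1 : y * ((r : ℝ) + k) ≤ T - T₀ := by
      rw [hy, hA, mul_assoc]; exact mul_le_mul_of_nonneg_left hxK ha0.le
    rw [hN]; rw [hT₀] at e1; linarith
  -- the light gate of the first factor
  obtain ⟨ρ₀, hρ₀⟩ : ∃ ρ₀ : ℝ, ρ₀ = (T₀ - 2 * (l : ℝ)) / ((h : ℝ) - l) := ⟨_, rfl⟩
  have hρ₀y : ρ₀ < y := by
    have : (T₀ - 2 * (l : ℝ)) / ((h : ℝ) - l) ≤ pairGate y T₀ l h := le_max_left _ _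
    rw [hρ₀]; rw [hy, hT₀] at this ⊢; linarith
  obtain ⟨γ, hγ⟩ : ∃ γ : ℝ, γ = y ^ 2 + (1 - y) * ρ₀ := ⟨_, rfl⟩
  have hγ' : pairGate (a * x) (a * S) l h = γ := by
    rw [hγ, hρ₀, hT₀, hy]; exact pairGate_eq_light (a * x) (a * S) l h (mul_pos ha0 hx0).le (by rw [← hy, ← hT₀, ← hρ₀]; exact hρ₀y.le)
  have eρ₀ : ρ₀ = (N - (T - T₀)) / d := by rw [hρ₀, hN, hd]; congr 1; ring
  have hρ₀0 : 0 < ρ₀ := by rw [hρ₀]; exact div_pos (by rw [hT₀]; linarith) (by linarith)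
  -- credit ratios of the two rows into h at T
  obtain ⟨ρa, hρa⟩ : ∃ ρa : ℝ, ρa = N / d := ⟨_, rfl⟩
  obtain ⟨ρb, hρb⟩ : ∃ ρb : ℝ, ρb = (N - 2 * (r : ℝ)) / (d - r) := ⟨_, rfl⟩
  have hdr : 0 < d - r := by linarith
  have hρay : ρa ≤ y := by rw [hρa, div_le_iff₀ hd0]; linarith
  have hρa0 : 0 < ρa := by rw [hρa]; exact div_pos (by linarith) hd0
  have hρb0 : 0 < ρb := by rw [hρb]; exact div_pos (by linarith) hdr
  have hN2d : N ≤ 2 * d := by rw [hN, hd, hT]; linarith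
  have hρba : ρb ≤ ρa := by
    rw [hρa, hρb, div_le_div_iff₀ hdr hd0]; linarith [mul_le_mul_of_nonneg_left hN2d hr0]
  have hρby : ρb ≤ y := le_trans hρba hρay
  -- exact light powers into h
  obtain ⟨Ga, hGa⟩ : ∃ Ga : ℝ, Ga = y ^ 2 + (1 - y) * ρa := ⟨_, rfl⟩
  obtain ⟨Gb, hGb⟩ : ∃ Gb : ℝ, Gb = y ^ 2 + (1 - y) * ρb := ⟨_, rfl⟩
  have hGa0 : 0 < Ga := by rw [hGa]; exact add_pos_of_pos_of_nonneg (pow_pos hy0 2) (mul_nonneg h1y.le hρa0.le)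
  have hGb0 : 0 < Gb := by rw [hGb]; exact add_pos_of_pos_of_nonneg (pow_pos hy0 2) (mul_nonneg h1y.le hρb0.le)
  have hGa1 : 0 < 1 - Ga := by
    rw [hGa, show 1 - (y ^ 2 + (1 - y) * ρa) = (1 - y) * (1 + y - ρa) by ring]; exact mul_pos h1y (by linarith)
  have hGb1 : 0 < 1 - Gb := by
    rw [hGb, show 1 - (y ^ 2 + (1 - y) * ρb) = (1 - y) * (1 + y - ρb) by ring]; exact mul_pos h1y (by linarith)
  obtain ⟨ϖa, hϖa⟩ : ∃ ϖa : ℝ, ϖa = (1 - Ga) / Ga := ⟨_, rfl⟩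
  obtain ⟨ϖb, hϖb⟩ : ∃ ϖb : ℝ, ϖb = (1 - Gb) / Gb := ⟨_, rfl⟩
  have hϖa0 : 0 < ϖa := by rw [hϖa]; exact div_pos hGa1 hGa0
  have hϖb0 : 0 < ϖb := by rw [hϖb]; exact div_pos hGb1 hGb0
  -- validity into h (exact light rate), into h + r (nearer-to-farther), and compatibility
  have hcompa : T < (l : ℝ) + h := by rw [hN, hd] at hNd; linarith
  have hcompb : T < ((l : ℝ) + r) + h := by
    have : N - (r : ℝ) < d := by linarith
    rw [hN, hd] at this; linarith
  have eLr : ((l + r : ℕ) : ℝ) = (l : ℝ) + r := by push_cast; ring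
  have eL2 : ((l + r + k : ℕ) : ℝ) = (l : ℝ) + r + k := by push_cast; ring
  have vaH : ϖa * usage y T j l h ≤ 1 := by
    have hρ : (T - 2 * (l : ℝ)) / ((h : ℝ) - l) ≤ y := by rw [← hN, ← hd, ← hρa]; exact hρay
    rw [usage_light_eq y T j l h hy0.le hhj hρ, ← hN, ← hd, ← hρa, ← hGa, hϖa, div_mul_div_comm, mul_comm (1 - Ga) Ga,
      div_self (mul_ne_zero hGa0.ne' hGa1.ne')]
  have vbH : ϖb * usage y T j (l + r) h ≤ 1 := by
    have e1 : (T - 2 * ((l + r : ℕ) : ℝ)) / ((h : ℝ) - ((l + r : ℕ) : ℝ)) = ρb := by rw [hρb, hN, hd, eLr]; ring_nf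
    have hρ : (T - 2 * ((l + r : ℕ) : ℝ)) / ((h : ℝ) - ((l + r : ℕ) : ℝ)) ≤ y := by rw [e1]; exact hρby
    rw [usage_light_eq y T j (l + r) h hy0.le hhj hρ, e1, ← hGb, hϖb, div_mul_div_comm, mul_comm (1 - Gb) Gb,
      div_self (mul_ne_zero hGb0.ne' hGb1.ne')]
  have hlowl : 2 * (l : ℝ) < T := by linarith
  have hlowlr : 2 * ((l + r : ℕ) : ℝ) < T := by rw [eLr]; linarith
  have vaG : ϖa * usage y T j l (h + r) ≤ 1 ∨ j < h + r := by
    by_cases hjr : h + r ≤ j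
    · exact Or.inl (le_trans (mul_le_mul_of_nonneg_left (usage_anti_mid y T j l h (h + r) hy0 hy1 (by omega) hjr hlowl hcompa) hϖa0.le) vaH)
    · exact Or.inr (by omega)
  have vbG : ϖb * usage y T j (l + r) (h + r) ≤ 1 ∨ j < h + r := by
    by_cases hjr : h + r ≤ j
    · refine Or.inl (le_trans (mul_le_mul_of_nonneg_left (usage_anti_mid y T j (l + r) h (h + r) hy0 hy1 (by omega) hjr hlowlr ?_) hϖb0.le) vbH)
      rw [eLr]; exact hcompb
    · exact Or.inr (by omega)
  -- the top copy A = l + r + k: exact heavy power for row l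
  obtain ⟨ϖA, hϖA⟩ : ∃ ϖA : ℝ, ϖA = ((l : ℝ) + ((l + r + k : ℕ) : ℝ) - T) / (T - 2 * (l : ℝ)) := ⟨_, rfl⟩
  have hAcomp' : T < (l : ℝ) + ((l + r + k : ℕ) : ℝ) := by rw [eL2]; rw [hN] at hNK; linarith
  have hAheavy : y * ((((l + r + k : ℕ) : ℝ)) - l) ≤ T - 2 * (l : ℝ) := by rw [eL2, ← hN]; linarith [hyK]
  have vA : ϖA * usage y T j l (l + r + k) ≤ 1 := by
    have e := GluedWindow.apow_heavy_valid y T 1 j l (l + r + k) hy0 hy1 hL2j hlowl hAcomp' hAheavy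
    rw [← hϖA, one_mul] at e
    exact e.le
  have eϖA : ϖA = ((r : ℝ) + k - N) / N := by rw [hϖA, eL2, hN]; congr 1; ring
  have hϖA0 : 0 ≤ ϖA := by rw [eϖA]; exact div_nonneg (by linarith) hN0.le
  -- branch I: t2 ϖA ≤ t0
  have hbr : t2 * ϖA ≤ 1 - t1 - t2 := by
    rw [eϖA, ← mul_div_assoc, div_le_iff₀ hN0, ht1, ht2, show (1 - q * (1 - g) - q * g) = 1 - q by ring]
    rw [hN, hT]; linarith [hbrI]
  -- the main inequality (1−γ)((t0 − t2ϖA)/ϖa + t1/ϖb) ≤ γ via (★I)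
  obtain ⟨cc, hcc⟩ : ∃ cc : ℝ, cc = 1 + y - ρa := ⟨_, rfl⟩
  obtain ⟨ee, hee⟩ : ∃ ee : ℝ, ee = (r : ℝ) / d := ⟨_, rfl⟩
  obtain ⟨kk, hkk⟩ : ∃ kk : ℝ, kk = ((r : ℝ) + k) / d := ⟨_, rfl⟩
  obtain ⟨aa, haa⟩ : ∃ aa : ℝ, aa = (T - T₀) / d := ⟨_, rfl⟩
  have enu : 1 + y - cc = ρa := by rw [hcc]; ring
  have hcc1 : 1 ≤ cc := by rw [hcc]; linarith
  have hccy : cc < 1 + y := by rw [hcc]; linarith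
  have hee0 : 0 ≤ ee := by rw [hee]; positivity
  have haa0 : 0 ≤ aa := by rw [haa]; positivity
  have hee1 : 2 * ee ≤ 1 + y - cc := by
    rw [hee, enu, hρa, show 2 * ((r : ℝ) / d) = (2 * r) / d by ring, div_le_div_iff₀ hd0 hd0]
    exact mul_le_mul_of_nonneg_right (by linarith) hd0.le
  have hkkn : 1 + y - cc ≤ kk := by rw [hkk, enu, hρa]; exact div_le_div_of_nonneg_right hNK.le hd0.le
  have eϖA' : ϖA = (kk - (1 + y - cc)) / (1 + y - cc) := by
    rw [eϖA, enu, hkk, hρa, ← sub_div, div_div_div_cancel_right₀ hd0.ne']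
  have hbr' : t2 * (kk - (1 + y - cc)) ≤ (1 - t1 - t2) * (1 + y - cc) := by
    have hn0 : 0 < 1 + y - cc := by linarith
    have := hbr; rw [eϖA', ← mul_div_assoc, div_le_iff₀ hn0] at this; exact this
  have haamax : aa ≤ t1 * ee + t2 * kk := by
    rw [haa, hee, hkk, show t1 * ((r : ℝ) / d) + t2 * (((r : ℝ) + k) / d) = (t1 * r + t2 * ((r : ℝ) + k)) / d by ring]
    exact div_le_div_of_nonneg_right hAm hd0.le
  have star := heavyTopI_star y t1 t2 cc ee kk hy0 hyt2 ht1p ht0p hcc1 hccy hee0 hee1 hy1 hkkn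
  have hden : 0 < cc + t1 * ee + t2 * kk := by
    have a1 : 0 ≤ t1 * ee := mul_nonneg ht1p hee0
    have a3 : 0 ≤ t2 * kk := mul_nonneg ht2p (by linarith)
    linarith [a1, a3]
  -- rewrite the ϖA-terms: t2 (kk − ν)/ν = t2 ϖA, (1−y) t2 kk/ν = (1−y) t2 (1 + ϖA)
  have hn0 : 0 < 1 + y - cc := by linarith
  have e1 : t2 * (kk - (1 + y - cc)) / (1 + y - cc) = t2 * ϖA := by rw [eϖA', mul_div_assoc]
  have e2 : (1 - y) * t2 * kk / (1 + y - cc) = t2 * (1 + ϖA) * (1 - y) := by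
    rw [eϖA', show 1 + (kk - (1 + y - cc)) / (1 + y - cc) = kk / (1 + y - cc) by
      rw [eq_div_iff hn0.ne', add_mul, div_mul_cancel₀ _ hn0.ne']; ring]
    ring
  rw [e1, e2] at star
  have star6 : ((1 - t1 - t2) - t2 * ϖA) / cc + t1 * (1 - ee) / (cc + (1 - y) * ee) + t2 * (1 + ϖA) * (1 - y) ≤ 1 / (cc + aa) := by
    refine le_trans star ?_
    rw [one_div_le_one_div hden (by linarith)]
    linarith
  -- (★I) in Z-form: Za = cc, 1/Zb = (1−ee)/(cc+(1−y)ee), Z = cc + aa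
  obtain ⟨Zb, hZb⟩ : ∃ Zb : ℝ, Zb = 1 + y - ρb := ⟨_, rfl⟩
  have hZb0 : 0 < Zb := by rw [hZb]; linarith
  have hcce : 0 < cc + (1 - y) * ee := by have := mul_nonneg h1y.le hee0; linarith
  have eZb : 1 / Zb = (1 - ee) / (cc + (1 - y) * ee) := by
    rw [div_eq_div_iff hZb0.ne' hcce.ne', one_mul, hZb, hcc, hee, hρb, hρa]
    field_simp
    ring
  have eZ : 1 + y - ρ₀ = cc + aa := by rw [hcc, haa, eρ₀, hρa, sub_div]; ring
  have star5 : ((1 - t1 - t2) - t2 * ϖA) / cc + t1 / Zb + t2 * (1 + ϖA) * (1 - y) ≤ 1 / (1 + y - ρ₀) := by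
    rw [eZ, div_eq_mul_one_div t1 Zb, eZb, ← mul_div_assoc]
    exact star6
  have main' := lightOnly_main_of_star5 y (1 + y - ρ₀) cc Zb ((1 - t1 - t2) - t2 * ϖA) t1 (t2 * (1 + ϖA)) hy1 (by linarith) (by linarith) hZb0
    (by ring) star5
  have eϖa : (1 - y) * cc / (1 - (1 - y) * cc) = ϖa := by
    rw [hϖa, hGa, hcc]; congr 1 <;> ring
  have eϖb : (1 - y) * Zb / (1 - (1 - y) * Zb) = ϖb := by
    rw [hϖb, hGb, hZb]; congr 1 <;> ring
  have e1γ : (1 - y) * (1 + y - ρ₀) = 1 - γ := by rw [hγ]; ring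
  rw [eϖa, eϖb, e1γ, show 1 - (1 - γ) = γ by ring] at main'
  -- main' : (1 − γ) * (((1 − t1 − t2) − t2 ϖA)/ϖa + t1/ϖb) ≤ γ
  have hγ0 : 0 < γ := by rw [hγ]; exact add_pos_of_pos_of_nonneg (pow_pos hy0 2) (mul_pos h1y hρ₀0).le
  have h1γ : 0 < 1 - γ := by
    rw [hγ, show 1 - (y ^ 2 + (1 - y) * ρ₀) = (1 - y) * (1 + y - ρ₀) by ring]; exact mul_pos h1y (by linarith)
  -- the share σ of the copies of h for row l, and the two coverages
  have hw0 : 0 ≤ (1 - t1 - t2) - t2 * ϖA := by linarith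
  obtain ⟨σ, hσ⟩ : ∃ σ : ℝ, σ = (1 - γ) * ((1 - t1 - t2) - t2 * ϖA) / (γ * ϖa) := ⟨_, rfl⟩
  have hγϖa : 0 < γ * ϖa := mul_pos hγ0 hϖa0
  have hσγ : σ * (γ * ϖa) = (1 - γ) * ((1 - t1 - t2) - t2 * ϖA) := by rw [hσ]; exact div_mul_cancel₀ _ hγϖa.ne'
  have hσ0 : 0 ≤ σ := by rw [hσ]; exact div_nonneg (mul_nonneg h1γ.le hw0) hγϖa.le
  have m2 : (1 - γ) * ((1 - t1 - t2) - t2 * ϖA) * ϖb + (1 - γ) * t1 * ϖa ≤ γ * ϖa * ϖb := by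
    have := mul_le_mul_of_nonneg_right main' (mul_nonneg hϖa0.le hϖb0.le)
    have ca : ((1 - t1 - t2) - t2 * ϖA) / ϖa * ϖa = (1 - t1 - t2) - t2 * ϖA := div_mul_cancel₀ _ hϖa0.ne'
    have cb : t1 / ϖb * ϖb = t1 := div_mul_cancel₀ _ hϖb0.ne'
    have e : (1 - γ) * (((1 - t1 - t2) - t2 * ϖA) / ϖa + t1 / ϖb) * (ϖa * ϖb)
        = (1 - γ) * ((1 - t1 - t2) - t2 * ϖA) * ϖb + (1 - γ) * t1 * ϖa := by
      linear_combination ((1 - γ) * ϖb) * ca + ((1 - γ) * ϖa) * cb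
    rw [e] at this; linarith
  have hσ1 : σ ≤ 1 := by
    rw [hσ, div_le_one hγϖa]
    have h3 : (1 - γ) * ((1 - t1 - t2) - t2 * ϖA) * ϖb ≤ γ * ϖa * ϖb := by
      linarith [m2, mul_nonneg (mul_nonneg h1γ.le ht1p) hϖa0.le]
    exact le_of_mul_le_mul_right h3 hϖb0
  have cov1' : (1 - γ) * t1 ≤ (1 - σ) * (γ * ϖb) := by
    have e : (1 - σ) * (γ * ϖb) * ϖa = γ * ϖa * ϖb - σ * (γ * ϖa) * ϖb := by ring
    have h2 : (1 - γ) * t1 * ϖa ≤ (1 - σ) * (γ * ϖb) * ϖa := by rw [e, hσγ]; linarith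
    exact le_of_mul_le_mul_right h2 hϖa0
  have et0 : 1 - t1 - t2 = 1 - q := by rw [ht1, ht2]; ring
  have h1σ : 0 ≤ 1 - σ := by linarith
  -- apply the reduction theorem (shares: row l ↦ A fully + σ of every copy of h; row l+r ↦ 1−σ of every copy of h)
  by_cases hjr : h + r ≤ j
  · have vaG' : ϖa * usage y T j l (h + r) ≤ 1 := by rcases vaG with h1 | h1; exacts [h1, absurd hjr (by omega)]
    have vbG' : ϖb * usage y T j (l + r) (h + r) ≤ 1 := by rcases vbG with h1 | h1; exacts [h1, absurd hjr (by omega)]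
    refine gluedPullback_windowPair_twoRow_mid_of_assign x a q g S B r k j l h c ls α p 0 ϖA ϖa ϖa ϖa 0 ϖb ϖb ϖb
      1 σ σ σ 0 (1 - σ) (1 - σ) (1 - σ)
      hx0 hx1 ha0 ha1 hq0 hq1 hg0 hg1 hr hlh hhB hwin hlow hcomp hL2j hL2mid hL1low hhmid (Or.inl ⟨hjr, rfl⟩) hhc hcB hcj hp hαp hcheap
      hϖA0 hϖa0.le hϖa0.le hϖa0.le le_rfl hϖb0.le hϖb0.le hϖb0.le zero_le_one hσ0 hσ0 hσ0 le_rfl h1σ h1σ h1σ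
      (by linarith) (by linarith) (by linarith) (by linarith)
      ?_ (Or.inr ?_) ?_ (Or.inr ?_) ?_ (Or.inr (Or.inr ?_)) (Or.inr ⟨?_, ?_⟩)
      ?_ (Or.inl rfl) ?_ (Or.inr ?_) ?_ (Or.inr (Or.inr ?_)) (Or.inr ⟨?_, ?_⟩) ?_ ?_
    · rw [← hy, ← hT]; exact vA
    · rw [← hT, ← eL2]; exact hAcomp'
    · rw [← hy, ← hT]; exact vaH
    · rw [← hT]; exact hcompa
    · rw [← hy, ← hT]; exact vaG'
    · rw [← hT]; linarith
    · rw [← hT]; exact hcompa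
    · rw [← hy, ← hT]; exact vaH
    · rw [zero_mul]; exact zero_le_one
    · rw [← hy, ← hT]; exact vbH
    · rw [← hT]; exact hcompb
    · rw [← hy, ← hT]; exact vbG'
    · rw [← hT]; linarith
    · rw [← hT]; exact hcompb
    · rw [← hy, ← hT]; exact vbH
    · rw [hγ', ← ht1, ← ht2, ← et0]
      have e : 1 * ((1 - γ) * t2 * ϖA) + σ * (γ * (1 - t1 - t2) * ϖa) + σ * (γ * t1 * (1 - 0) * ϖa) + σ * (γ * (t2 + 0 * t1) * ϖa)
          = (1 - γ) * t2 * ϖA + σ * (γ * ϖa) := by ring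
      rw [e, hσγ]; linarith
    · rw [hγ', ← ht1, ← ht2]
      have e : 0 * ((1 - γ) * t2 * 0) + (1 - σ) * (γ * (1 - q) * ϖb) + (1 - σ) * (γ * t1 * (1 - 0) * ϖb) + (1 - σ) * (γ * (t2 + 0 * t1) * ϖb)
          = (1 - σ) * (γ * ϖb) * ((1 - q) + t1 + t2) := by ring
      rw [e, ← et0, show 1 - t1 - t2 + t1 + t2 = (1:ℝ) by ring, mul_one]
      exact cov1'
  · have hjr' : j < h + r := by omega
    refine gluedPullback_windowPair_twoRow_mid_of_assign x a q g S B r k j l h c ls α p 1 ϖA ϖa 0 ϖa 0 ϖb 0 ϖb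
      1 σ σ σ 0 (1 - σ) (1 - σ) (1 - σ)
      hx0 hx1 ha0 ha1 hq0 hq1 hg0 hg1 hr hlh hhB hwin hlow hcomp hL2j hL2mid hL1low hhmid (Or.inr ⟨hjr', rfl⟩) hhc hcB hcj hp hαp hcheap
      hϖA0 hϖa0.le le_rfl hϖa0.le le_rfl hϖb0.le le_rfl hϖb0.le zero_le_one hσ0 hσ0 hσ0 le_rfl h1σ h1σ h1σ
      (by linarith) (by linarith) (by linarith) (by linarith)
      ?_ (Or.inr ?_) ?_ (Or.inr ?_) ?_ (Or.inl rfl) (Or.inr ⟨?_, ?_⟩)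
      ?_ (Or.inl rfl) ?_ (Or.inr ?_) ?_ (Or.inl rfl) (Or.inr ⟨?_, ?_⟩) ?_ ?_
    · rw [← hy, ← hT]; exact vA
    · rw [← hT, ← eL2]; exact hAcomp'
    · rw [← hy, ← hT]; exact vaH
    · rw [← hT]; exact hcompa
    · rw [zero_mul]; exact zero_le_one
    · rw [← hT]; exact hcompa
    · rw [← hy, ← hT]; exact vaH
    · rw [zero_mul]; exact zero_le_one
    · rw [← hy, ← hT]; exact vbH
    · rw [← hT]; exact hcompb
    · rw [zero_mul]; exact zero_le_one
    · rw [← hT]; exact hcompb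
    · rw [← hy, ← hT]; exact vbH
    · rw [hγ', ← ht1, ← ht2, ← et0]
      have e : 1 * ((1 - γ) * t2 * ϖA) + σ * (γ * (1 - t1 - t2) * ϖa) + σ * (γ * t1 * (1 - 1) * 0) + σ * (γ * (t2 + 1 * t1) * ϖa)
          = (1 - γ) * t2 * ϖA + σ * (γ * ϖa) := by ring
      rw [e, hσγ]; linarith
    · rw [hγ', ← ht1, ← ht2]
      have e : 0 * ((1 - γ) * t2 * 0) + (1 - σ) * (γ * (1 - q) * ϖb) + (1 - σ) * (γ * t1 * (1 - 1) * 0) + (1 - σ) * (γ * (t2 + 1 * t1) * ϖb)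
          = (1 - σ) * (γ * ϖb) * ((1 - q) + t1 + t2) := by ring
      rw [e, ← et0, show 1 - t1 - t2 + t1 + t2 = (1:ℝ) by ring, mul_one]
      exact cov1'

end LawDec
end Quant
end Summit.CriticalPhenomena.PercolationContinuityZ3.Theorems
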